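import Literature.Probability.Moments.HutchinsonTraceEstimator
import Literature.Computability.QuantumComplexity.SampledCorrelationError
import HarnessLib

/-!
# Hutchinson's trace estimator with `N` probes: mean-squared error `Var₁/N` and the Chebyshev count

Companion of `HutchinsonTraceEstimator.lean` (one Rademacher probe: unbiasedness `hutchinson_mean`
and the single-sample variance `hutchinson_variance`, `= 2(‖A‖_F² − Σ_i A_ii²)` for symmetric `A`).

The estimator actually used is the average of `N` independent probes
(Roosta-Khorasani–Ascher, *Improved bounds on sample size for implicit matrix trace estimators*,
Found. Comput. Math. 15 (2015) = arXiv:1308.2475, §1 eq. (1), held text p0003: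
"`tr_D^N(A) := (1/N) Σ_{i=1}^N w_iᵀ A w_i` … the original method … is due to Hutchinson and uses the
Rademacher distribution for `D` … the main analysis and comparison of such methods was based on the
variance of one sample"; Saibaba–Alexanderian–Ipsen, Numer. Math. 137 (2017) = arXiv:1605.04893,
§2.3, held text p0007: "The reliability of Monte Carlo estimators is judged by the variance of a
single sample. This variance is `2(‖A‖_F² − Σ_j A_jj²)` for the Hutchinson estimator" and the
`(ε, δ)` estimator `P(|trace(A) − (1/N) Σ_j z_jᵀ A z_j| ≤ ε·trace(A)) ≥ 1 − δ`).

In the tree's finite-probability language (`N` probes = sequences `ω : Fin N → Finset ι` of sign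
patterns weighted by the product of the uniform weights `2^{−n}`; `wmean` / `wvar` of
`XEBSampleComplexity.lean`; the i.i.d. bias–variance identity `sum_prodWeight_mul_sq_mean_sub` of
`SampledCorrelationError.lean`, [DevoreBerkCarlton2021] §6.2 `V(X̄) = σ²/n`):

* `probeWeight`, `wmean_sample` (`= tr A`), `wvar_sample` / `wvar_sample_of_symm` — the one-probe
  mean and variance re-expressed as `wmean` / `wvar`;
* `estimateN A N ω = (1/N) Σ_k z_{ω k}ᵀ A z_{ω k}` — the `N`-probe estimator (RA eq. (1));
* `hutchinson_mse` — **`E[(tr^N(A) − tr A)²] = Var₁(A)/N`** exactly, with `Var₁` the single-sample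
  variance; `hutchinson_mse_of_symm` — `= 2(‖A‖_F² − Σ_i A_ii²)/N` for symmetric `A`;
* `hutchinson_tail` — the finite Chebyshev bound: the weight of the probe sequences with
  `|tr^N(A) − tr A| ≥ ε` is at most `Var₁(A)/(N ε²)`; `hutchinson_tail_le_of_count` —
  `N ≥ Var₁(A)/(ε² δ)` probes make it `≤ δ` (the variance-based `(ε, δ)` count; the sharper
  Chernoff-type counts `6 ε⁻² log(2/δ)` of Avron–Toledo / Roosta-Khorasani–Ascher are NOT
  formalised here).

Everything is a finite sum and is proved; no named facts.  Consumer (cell pub-qadeq): DEQ-A154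
Prop. A154-B (b) ("`T̂_M = M⁻¹ Σ z_mᵀ K⁻¹(∂K) z_m` … unbiased … with `Var = 2(‖A_s‖_F² − Σ_i (A_s)_ii²)/M`")
and the trace-estimation comparator rows A-81 / A-58 / A-07.

## References
* [RoostaKhorasaniAscher2015] F. Roosta-Khorasani, U. Ascher, Found. Comput. Math. 15 (2015)
  1187–1212 = arXiv:1308.2475, §1 eq. (1) (the `N`-probe estimator `tr_D^N`).
* [SaibabaAlexanderianIpsen2017] A. K. Saibaba, A. Alexanderian, I. C. F. Ipsen, Numer. Math. 137
  (2017) 353–395 = arXiv:1605.04893, §2.3.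
* [Hutchinson1990] M. F. Hutchinson, Commun. Statist. Simul. Comput. 19 (1990) 433–450.
* [DevoreBerkCarlton2021] J. L. Devore, K. N. Berk, M. A. Carlton, *Modern Mathematical Statistics
  with Applications*, 3rd ed. (2021), §6.2 (`E(X̄) = μ`, `V(X̄) = σ²/n`) — through
  `sum_prodWeight_mul_sq_mean_sub`.
* [BarakChouGao2021] B. Barak, C.-N. Chou, X. Gao, ITCS 2021, §6.1 Lemma "sample complexity and
  variance" (the Chebyshev count `T ≥ Var/(ε²δ)`, same argument).
-/

noncomputable section

open Finset Matrix

namespace Literature.Probability.Moments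

namespace Hutchinson

open Literature.Computability.QuantumComplexity
open Literature.Computability.QuantumComplexity.XEB (wmean wvar wvar_nonneg)

variable {ι : Type*} [Fintype ι] [DecidableEq ι]

/-! ### One probe as a weighted statistic -/

/-- The uniform weight `2^{−n}` of each sign pattern (one Rademacher probe).
[cite: SaibabaAlexanderianIpsen2017, §1 (Rademacher probes `z_j`)] -/
def probeWeight (ι : Type*) [Fintype ι] : Finset ι → ℝ := fun _ => ((2 : ℝ) ^ Fintype.card ι)⁻¹

omit [DecidableEq ι] in
/-- The probe weights are nonnegative. [cite: SaibabaAlexanderianIpsen2017, §1] -/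
theorem probeWeight_nonneg (s : Finset ι) : 0 ≤ probeWeight ι s := by
  unfold probeWeight
  positivity

omit [DecidableEq ι] in
/-- The probe weights sum to one (`2ⁿ` patterns of weight `2^{−n}`).
[cite: SaibabaAlexanderianIpsen2017, §1] -/
theorem sum_probeWeight : ∑ s : Finset ι, probeWeight ι s = 1 := by
  simp only [probeWeight, sum_const, card_univ, Fintype.card_finset, nsmul_eq_mul, Nat.cast_pow,
    Nat.cast_ofNat]
  exact mul_inv_cancel₀ (by positivity)

/-- The one-probe mean is the trace: `E[zᵀAz] = tr A`. [cite: SaibabaAlexanderianIpsen2017, §1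
("produces an unbiased estimator"); Hutchinson1990] -/
theorem wmean_sample (A : Matrix ι ι ℝ) : wmean (probeWeight ι) (sample A) = A.trace := by
  unfold wmean probeWeight
  rw [← mul_sum]
  exact hutchinson_mean A

/-- The one-probe variance as `wvar`: `Var₁(A) = Σ_i Σ_{j ≠ i} A_ij (A_ij + A_ji)`.
[cite: SaibabaAlexanderianIpsen2017, §2.3] -/
theorem wvar_sample (A : Matrix ι ι ℝ) :
    wvar (probeWeight ι) (sample A) =
      ∑ i, ∑ j ∈ univ.filter (fun j => j ≠ i), A i j * (A i j + A j i) := by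
  unfold wvar
  rw [wmean_sample]
  unfold probeWeight
  rw [← mul_sum]
  exact hutchinson_variance A

/-- For symmetric `A`: `Var₁(A) = 2(‖A‖_F² − Σ_i A_ii²)`. [cite: SaibabaAlexanderianIpsen2017, §2.3
("This variance is `2(‖A‖_F² − Σ_j A_jj²)` for the Hutchinson estimator")] -/
theorem wvar_sample_of_symm (A : Matrix ι ι ℝ) (hA : A.IsSymm) :
    wvar (probeWeight ι) (sample A) = 2 * (∑ i, ∑ j, A i j ^ 2 - ∑ i, A i i ^ 2) := by
  rw [wvar_sample, offDiag_sum_of_symm A hA]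

/-! ### `N` probes -/

/-- **The `N`-probe Hutchinson estimator** `tr^N(A) = (1/N) Σ_{k} z_{ω_k}ᵀ A z_{ω_k}` on a sequence
`ω` of `N` sign patterns. [cite: RoostaKhorasaniAscher2015, §1 eq. (1) (`tr_D^N(A) := (1/N)
Σ_{i=1}^N w_iᵀ A w_i`); SaibabaAlexanderianIpsen2017, §2.3 (`(1/N) Σ_{j=1}^N z_j^* A z_j`)] -/
def estimateN (A : Matrix ι ι ℝ) (N : ℕ) (ω : Fin N → Finset ι) : ℝ := (∑ k, sample A (ω k)) / N

/-- **Mean-squared error of the `N`-probe estimator**: averaging over the `N` independent uniformly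
distributed sign patterns, `E[(tr^N(A) − tr A)²] = Var₁(A)/N` exactly (unbiasedness + `V(X̄) = σ²/N`).
[cite: SaibabaAlexanderianIpsen2017, §2.3 (reliability judged by the single-sample variance);
DevoreBerkCarlton2021, §6.2 (`V(X̄) = σ²/n`)] -/
theorem hutchinson_mse (A : Matrix ι ι ℝ) {N : ℕ} (hN : 0 < N) :
    ∑ ω : Fin N → Finset ι, (∏ k, probeWeight ι (ω k)) * (estimateN A N ω - A.trace) ^ 2 =
      wvar (probeWeight ι) (sample A) / N := by
  unfold estimateN
  rw [sum_prodWeight_mul_sq_mean_sub (probeWeight ι) sum_probeWeight (sample A) A.trace hN,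
    wmean_sample, sub_self, zero_pow two_ne_zero, zero_add]

/-- The same for symmetric `A`: `E[(tr^N(A) − tr A)²] = 2(‖A‖_F² − Σ_i A_ii²)/N`.
[cite: SaibabaAlexanderianIpsen2017, §2.3] -/
theorem hutchinson_mse_of_symm (A : Matrix ι ι ℝ) (hA : A.IsSymm) {N : ℕ} (hN : 0 < N) :
    ∑ ω : Fin N → Finset ι, (∏ k, probeWeight ι (ω k)) * (estimateN A N ω - A.trace) ^ 2 =
      2 * (∑ i, ∑ j, A i j ^ 2 - ∑ i, A i i ^ 2) / N := by
  rw [hutchinson_mse A hN, wvar_sample_of_symm A hA]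

omit [DecidableEq ι] in
/-- Product weights are nonnegative. [folklore] -/
private theorem prodWeight_nonneg {N : ℕ} (ω : Fin N → Finset ι) :
    0 ≤ ∏ k, probeWeight ι (ω k) :=
  prod_nonneg fun k _ => probeWeight_nonneg (ω k)

/-- **Chebyshev tail for the `N`-probe estimator** (finite form): for `ε > 0` the total weight of
the probe sequences with `|tr^N(A) − tr A| ≥ ε` is at most `Var₁(A)/(N ε²)`.
[cite: SaibabaAlexanderianIpsen2017, §2.3 (the `(ε, δ)` estimator); BarakChouGao2021, §6.1 Lemma
‘sample complexity and variance’ (Chebyshev)] -/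
theorem hutchinson_tail (A : Matrix ι ι ℝ) {N : ℕ} (hN : 0 < N) {ε : ℝ} (hε : 0 < ε) :
    ∑ ω ∈ univ.filter (fun ω : Fin N → Finset ι => ε ≤ |estimateN A N ω - A.trace|),
        ∏ k, probeWeight ι (ω k) ≤ wvar (probeWeight ι) (sample A) / (N * ε ^ 2) := by
  have hε2 : 0 < ε ^ 2 := by positivity
  -- Markov on the squared deviation: on the event, `1 ≤ (dev/ε)²`
  have hstep : ∑ ω ∈ univ.filter (fun ω : Fin N → Finset ι => ε ≤ |estimateN A N ω - A.trace|),
      ∏ k, probeWeight ι (ω k) ≤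
      ∑ ω ∈ univ.filter (fun ω : Fin N → Finset ι => ε ≤ |estimateN A N ω - A.trace|),
        (∏ k, probeWeight ι (ω k)) * (estimateN A N ω - A.trace) ^ 2 / ε ^ 2 := by
    refine sum_le_sum fun ω hω => ?_
    have hdev : ε ≤ |estimateN A N ω - A.trace| := (mem_filter.mp hω).2
    have hsq : ε ^ 2 ≤ (estimateN A N ω - A.trace) ^ 2 := by
      rw [← sq_abs (estimateN A N ω - A.trace)]
      exact pow_le_pow_left₀ hε.le hdev 2
    have hw := prodWeight_nonneg (ι := ι) ω
    rw [le_div_iff₀ hε2]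
    exact mul_le_mul_of_nonneg_left hsq hw
  refine hstep.trans ?_
  -- extend the sum to all sequences and use the exact MSE
  have hall : ∑ ω ∈ univ.filter (fun ω : Fin N → Finset ι => ε ≤ |estimateN A N ω - A.trace|),
      (∏ k, probeWeight ι (ω k)) * (estimateN A N ω - A.trace) ^ 2 / ε ^ 2 ≤
      ∑ ω : Fin N → Finset ι, (∏ k, probeWeight ι (ω k)) * (estimateN A N ω - A.trace) ^ 2 / ε ^ 2 :=
    sum_le_sum_of_subset_of_nonneg (filter_subset _ _) fun ω _ _ =>
      div_nonneg (mul_nonneg (prodWeight_nonneg ω) (sq_nonneg _)) hε2.le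
  refine hall.trans (le_of_eq ?_)
  rw [← sum_div, hutchinson_mse A hN, div_div]

/-- **The variance-based `(ε, δ)` count**: `N ≥ Var₁(A)/(ε² δ)` probes make the weight of
`{|tr^N(A) − tr A| ≥ ε}` at most `δ`. [cite: SaibabaAlexanderianIpsen2017, §2.3 (`(ε,δ)` estimator);
BarakChouGao2021, §6.1 Lemma ‘sample complexity and variance’ (`T ≥ Var/(ε²δ)`)] -/
theorem hutchinson_tail_le_of_count (A : Matrix ι ι ℝ) {N : ℕ} (hN : 0 < N) {ε δ : ℝ}
    (hε : 0 < ε) (hδ : 0 < δ) (hcount : wvar (probeWeight ι) (sample A) / (ε ^ 2 * δ) ≤ N) :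
    ∑ ω ∈ univ.filter (fun ω : Fin N → Finset ι => ε ≤ |estimateN A N ω - A.trace|),
        ∏ k, probeWeight ι (ω k) ≤ δ := by
  refine (hutchinson_tail A hN hε).trans ?_
  have hNpos : (0 : ℝ) < N := by exact_mod_cast hN
  rw [div_le_iff₀ (by positivity)]
  rw [div_le_iff₀ (by positivity)] at hcount
  calc wvar (probeWeight ι) (sample A) ≤ N * (ε ^ 2 * δ) := hcount
    _ = δ * (N * ε ^ 2) := by ring

end Hutchinson

end Literature.Probability.Moments

end
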